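import Summits.QuantumFields.BalabanUV.Beta.GAN24.VHWordsZeroLattice

/-!
# `BalabanUV.Beta.GAN24.NoFFWordCurrentKill` — binder row G-an2-4 ∕ (CONV-C), W-slot CT-W, conservation law (C)∕(C)sym AT LEVELS `j ≥ 1`, the GENERIC HALF of 24_j (this lineage's
# note `HOME/b2b-balaban-gan24-formalise-leaf-04/g67/CSYM-LEVEL0-KERNEL-BLUEPRINT.md` §11 «NEXT», leaf-06 g52's memo `…/leaf-06/g52/C-LEVELS-GE1.md` §17 (W9)): **A TWO-FACE WORD
# `(P ∘ Y) ∘ R_{u′}` SUMMED OVER THE BOND `u′` VANISHES WHENEVER THE LEFT FACTOR `P` HAS NO FIELD–FIELD BLOCK, THE RIGHT FAMILY `R` HAS NO MULTIPLIER FIRST LEGS, AND THE MULTIPLIER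
# ROWS OF THE MIDDLE KERNEL `Y` KILL THE BOND-RESUMMED RIGHT CURRENT `t(b,z) = Σ'_{(u′,w)} ρ₂(w)·R_{u′} z w (inl b) g`; AND ITS SWAP TWIN BY TRANSPOSITION** — 24 §2's
# `tsum_noFF_left_wilson_right_word_eq_zero_of` with the Wilson family replaced by ANY vertex family and its current

NOT IN PRINT; OUR BOOKKEEPING ([folklore] Fubini bookkeeping BY NAME over 22 `ExchangeSlotResum.hasSum_slot_word ∕ tsum_twoFace_eq_trK`, 18 `EEWordValue.fubini3`, 24
`VHWordsZeroLattice.comp_noFF_inl_inl`, an5's `TameKernelCalculus` (`trK`, `comp_assoc_tame`), an2's `BorderedHessian.sgnK`, an2's `BalabanStepJetsSucc.biLoc_comp_right`; G-an2-4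
formalisation swarm, leaf prover `b2b-balaban-gan24-formalise-leaf-04`, gen 68).  HONEST FRAMING (cell contract, verbatim): «discharging `BetaPertH` makes Bałaban's UV stability
UNCONDITIONAL — a real constructive-QFT result; it is NOT the continuum limit and NOT the Clay problem.»  HONEST DEPENDENCY (verbatim): «continuum YM on T⁴ ⇐ BetaPertH ∧ nine spine
estimates (0/9 proved); BetaPertH ⇐ (D1) ∧ (D4) ∧ CAP+tail; G-an2-4 gates asym, D1 and NE2/3/4.»

WHY.  At level `0` the `VH_c ⊗ E_{u′}` word of the dressed source's ff zero mode died because the Wilson slot resums to a divergence-free `Lc`-periodic exit-face current with zero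
cell totals and the multiplier rows of `X̃♮_0` kill such currents (24 + 14).  At level `j ≥ 1` the right family is the chain-rule vertex over the value-function cubic table
`e3OfK` (an2's `SpineRecursiveW.SpureRecAt_succ`), whose resummed current is a different object (leaf-06 g52 `ExitFaceHalfVertexSplit`); the word-level bookkeeping is the same.
This file isolates it: the ONLY level-dependent input left is the kill hypothesis `hkill` on the current (supplied at every `j` by `DressedKernelOnCurrentStep.tsum_dressedStep_inr_mul_current`
once the current is `Lc`-periodic, divergence-free, with zero cell totals).

WHAT ([folklore]; generic `d`, blocking `N`; 0 `def`, 0 cited facts, 0 `def … : Prop`, 0 sorry): §1 `exists_common_rate` (one rate for `P`, `Y`, `P ∘ Y`, `R`);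
**`tsum_noFF_left_right_word_eq_zero_of_current`** — for `P` bi-localised at one point with `P (inl ·)(inl ·) = 0`, `Y` decaying, `R_{u′}` bi-localised at `N•u′` with
`R_{u′} (inr ·) g = 0`, weights `|ρ₁|, |ρ₂| ≤ 1`, a bounded `t` with `Σ'_{(u′,w)} ρ₂(w)·R_{u′} z w (inl b) g = t b z` and `Σ'_z Σ_b Y y₁ z (inr m)(inl b)·t b z = 0`:
`Σ'_{u′} Σ'_{(y,w)} ρ₁(y)ρ₂(w)·((P ∘ Y) ∘ R_{u′}) y w (inl α′) g = 0`; §2 **`tsum_left_right_noFF_swap_word_eq_zero_of_current`** — the SWAP word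
`Σ'_{u′} Σ'_{(y,w)} ρ₁(y)ρ₂(w)·((R_{u′} ∘ Y) ∘ P) y w (inl α′)(inl β′) = 0` for `trK Y = sgnK Y`, `trK (R u′) = −R u′`, and the kill hypothesis for the `ρ₁`-weighted current
read at the leg `inl α′`.  Asserts NO value of Bałaban's tables; discharges NOTHING of (C)sym ∕ (Q-D) ∕ (Q-D-rate) ∕ «T2Shape» ∕ «T2Drift» ∕ (hW, hWall); NEVER «G-an2-4 closed» as
(CONV-C); NOT D1, NOT `BetaPertH`, NOT continuum, NOT Clay.  2026-08-23; no existing file touched.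
-/

noncomputable section

open Finset
open scoped BigOperators
open Literature.MathematicalPhysics.QuantumFieldTheory
open Literature.MathematicalPhysics.QuantumFieldTheory.Balaban1983to89
open Literature.MathematicalPhysics.QuantumFieldTheory.Balaban1983to89.Beta
open B12Sec2to5 (l1 l1_nonneg)
open ExpKernelCalculus (Site MKer comp Decays BiLoc)
open OneStepResolventKernel (Fib decays_mono biLoc_mono)
open BalabanStepJetsSucc (biLoc_comp_right)
open Summit.QuantumFields.BalabanUV.Beta.GAN24.EEWordValue (fubini3)
open Summit.QuantumFields.BalabanUV.Beta.TameKernelCalculus (trK trK_apply trK_comp biLoc_trK Loc Spr Tame comp_assoc_tame comp_neg_right)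
open Summit.QuantumFields.BalabanUV.Beta.BorderedHessian (sgnK sgnK_apply sgnF_inl sgnF_inr decays_sgnK)
open Summit.QuantumFields.BalabanUV.Beta.GAN24.ExchangeSlotResum (hasSum_slot_word tsum_twoFace_eq_trK)
open Summit.QuantumFields.BalabanUV.Beta.GAN24.VHWordsZeroLattice (comp_noFF_inl_inl)

namespace Summit.QuantumFields.BalabanUV.Beta.GAN24.NoFFWordCurrentKill

variable {d : ℕ} {N : ℕ} [NeZero N]

/-! ## §1 The direct word -/

section Direct

variable {P Y : MKer (d + 1) (Fib d)} {p : Site (d + 1)} {CP δP CY δY CR δR : ℝ} {R : Site (d + 1) → MKer (d + 1) (Fib d)}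

omit [NeZero N] in
/-- [folklore] **COMMON-RATE DECAY DATA**: for a left factor `P` bi-localised at `(p, p)`, a decaying middle kernel `Y` and a family `R_{u′}` bi-localised at `N•u′`, one rate
`δ > 0` at which `Y` decays, `R` is bi-localised, and `P`, `P ∘ Y` are bi-localised at `(p, p)` (`biLoc_comp_right`). -/
theorem exists_common_rate (hP : BiLoc P p p CP δP) (hδP : 0 < δP) (hY : Decays Y CY δY) (hδY : 0 < δY)
    (hR : ∀ u', BiLoc (R u') ((N : ℤ) • u') ((N : ℤ) • u') CR δR) (hδR : 0 < δR) :
    ∃ δ CA : ℝ, 0 < δ ∧ 0 ≤ CA ∧ Decays Y CY δ ∧ (∀ u', BiLoc (R u') ((N : ℤ) • u') ((N : ℤ) • u') CR δ) ∧ BiLoc (comp P Y) p p CA δ ∧ BiLoc P p p CP δ := by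
  have hCP : 0 ≤ CP := hP.nonneg (Sum.inl 0)
  have hCY : 0 ≤ CY := hY.nonneg (Sum.inl 0)
  have hCR : 0 ≤ CR := (hR 0).nonneg (Sum.inl 0)
  set δ₁ : ℝ := min δP (min δY δR) with hδ₁
  have hδ₁0 : 0 < δ₁ := lt_min hδP (lt_min hδY hδR)
  have h1P : δ₁ ≤ δP := min_le_left _ _
  have h1Y : δ₁ ≤ δY := (min_le_right _ _).trans (min_le_left _ _)
  have h1R : δ₁ ≤ δR := (min_le_right _ _).trans (min_le_right _ _)
  have hP1 : BiLoc P p p CP (δ₁ / 2) := biLoc_mono hP hCP (by linarith)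
  have hY1 : Decays Y CY (δ₁ / 2) := decays_mono hY hCY le_rfl (by linarith)
  obtain ⟨CA, hA⟩ : ∃ CA : ℝ, BiLoc (comp P Y) p p CA (δ₁ / 4) := ⟨_, biLoc_comp_right hP1 hY1 (by positivity) (by linarith)⟩
  exact ⟨δ₁ / 4, CA, by positivity, hA.nonneg (Sum.inl 0), decays_mono hY hCY le_rfl (by linarith), fun u' => biLoc_mono (hR u') hCR (by linarith), hA,
    biLoc_mono hP hCP (by linarith)⟩

/-- [folklore] **A TWO-FACE WORD `(P ∘ Y) ∘ R_{u′}` SUMMED OVER THE BOND `u′` VANISHES** when the left factor `P` (bi-localised at one point) has NO ff block, the right family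
`R_{u′}` (bi-localised at `N•u′`) has no multiplier first legs against the outer leg `g`, and the multiplier rows of the decaying middle kernel `Y` kill the bond-resummed right
current `t(b,z) = Σ'_{(u′,w)} ρ₂(w)·R_{u′} z w (inl b) g` (bounded).  ROUTE (24 §2 verbatim with the Wilson family abstracted): `hasSum_slot_word` resums `u′`; multiplier middle
legs carry nothing (`hRmf`); field middle legs carry `t`; the ff entries of `P ∘ Y` pass through multiplier legs only (`comp_noFF_inl_inl`), so `fubini3` regroups the word as
`Σ'_{y₁} Σ_m (Σ'_y ρ₁·P(y,y₁)(inl α′, inr m))·(Σ'_z Σ_b Y y₁ z (inr m)(inl b)·t(b,z))`, whose last factor is `hkill`. -/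
theorem tsum_noFF_left_right_word_eq_zero_of_current (hP : BiLoc P p p CP δP) (hδP : 0 < δP)
    (hPff : ∀ (y z : Site (d + 1)) (α' a : Fin (d + 1)), P y z (Sum.inl α') (Sum.inl a) = 0)
    (hY : Decays Y CY δY) (hδY : 0 < δY) (hR : ∀ u', BiLoc (R u') ((N : ℤ) • u') ((N : ℤ) • u') CR δR) (hδR : 0 < δR)
    {g : Fib d} (hRmf : ∀ (u' z w : Site (d + 1)) (m : Fin (d + 1)), R u' z w (Sum.inr m) g = 0)
    {ρ₁ ρ₂ : Site (d + 1) → ℝ} (h₁ : ∀ y, |ρ₁ y| ≤ 1) (h₂ : ∀ w, |ρ₂ w| ≤ 1)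
    {t : Fin (d + 1) → Site (d + 1) → ℝ} {M : ℝ} (ht : ∀ (b : Fin (d + 1)) (z : Site (d + 1)), ∑' uw : Site (d + 1) × Site (d + 1), ρ₂ uw.2 * R uw.1 z uw.2 (Sum.inl b) g = t b z)
    (htb : ∀ b z, |t b z| ≤ M) (hkill : ∀ (y₁ : Site (d + 1)) (m : Fin (d + 1)), ∑' z : Site (d + 1), ∑ b : Fin (d + 1), Y y₁ z (Sum.inr m) (Sum.inl b) * t b z = 0)
    (α' : Fin (d + 1)) :
    ∑' u' : Site (d + 1), ∑' yw : Site (d + 1) × Site (d + 1), ρ₁ yw.1 * ρ₂ yw.2 * comp (comp P Y) (R u') yw.1 yw.2 (Sum.inl α') g = 0 := by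
  classical
  obtain ⟨δ, CA, hδ, hCA, hYd, hRd, hA, hPδ⟩ := exists_common_rate (N := N) hP hδP hY hδY hR hδR
  have hM : 0 ≤ M := (abs_nonneg _).trans (htb 0 0)
  -- step 1: resum the slot
  rw [(hasSum_slot_word (N := N) (A := comp P Y) (Q := R) hδ hA hRd h₁ h₂ (Sum.inl α') g).tsum_eq, Fintype.sum_sum_type]
  -- step 2: multiplier middle legs carry nothing
  have hinr : ∀ m : Fin (d + 1), (∑' yz : Site (d + 1) × Site (d + 1), ρ₁ yz.1 * comp P Y yz.1 yz.2 (Sum.inl α') (Sum.inr m) *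
      ∑' uw : Site (d + 1) × Site (d + 1), ρ₂ uw.2 * R uw.1 yz.2 uw.2 (Sum.inr m) g) = 0 := by
    intro m
    simp only [hRmf, mul_zero, tsum_zero]
  simp only [hinr, Finset.sum_const_zero, add_zero]
  -- step 3: field middle legs carry the current; the ff entries of `P ∘ Y` pass through multiplier legs
  simp only [ht, comp_noFF_inl_inl hPff]
  -- step 4: regroup
  rw [fubini3 (ι := Fin (d + 1)) (f := ρ₁) (V := fun y y₁ m => P y y₁ (Sum.inl α') (Sum.inr m)) (X := fun y₁ z m b => Y y₁ z (Sum.inr m) (Sum.inl b)) (T := t)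
    (c := p) hδ (hP.nonneg (Sum.inl 0)) (hY.nonneg (Sum.inl 0)) hM h₁ (fun y y₁ m => hPδ y y₁ (Sum.inl α') (Sum.inr m))
    (fun y₁ z m b => hYd y₁ z (Sum.inr m) (Sum.inl b)) htb]
  -- step 5: the multiplier rows of `Y` kill the current
  simp only [hkill, mul_zero, Finset.sum_const_zero, tsum_zero]

end Direct

/-! ## §2 The swap word, by transposition -/

section Swap

variable {P Y : MKer (d + 1) (Fib d)} {p : Site (d + 1)} {CP δP CY δY CR δR : ℝ} {R : Site (d + 1) → MKer (d + 1) (Fib d)}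

omit [NeZero N] in
/-- [folklore] The transpose of a kernel with no ff block has no ff block. -/
theorem trK_noFF {P : MKer (d + 1) (Fib d)} (hPff : ∀ (y z : Site (d + 1)) (α' a : Fin (d + 1)), P y z (Sum.inl α') (Sum.inl a) = 0)
    (y z : Site (d + 1)) (α' a : Fin (d + 1)) : trK P y z (Sum.inl α') (Sum.inl a) = 0 := by
  rw [trK_apply]; exact hPff z y a α'

omit [NeZero N] in
/-- [folklore] The multiplier rows of `sgnK Y` are minus those of `Y` on field second legs, so they kill the same currents. -/
theorem tsum_sgnK_inr_mul_eq_zero {Y : MKer (d + 1) (Fib d)} {t : Fin (d + 1) → Site (d + 1) → ℝ}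
    (hkill : ∀ (y₁ : Site (d + 1)) (m : Fin (d + 1)), ∑' z : Site (d + 1), ∑ b : Fin (d + 1), Y y₁ z (Sum.inr m) (Sum.inl b) * t b z = 0)
    (y₁ : Site (d + 1)) (m : Fin (d + 1)) : ∑' z : Site (d + 1), ∑ b : Fin (d + 1), sgnK Y y₁ z (Sum.inr m) (Sum.inl b) * t b z = 0 := by
  have es : ∀ z : Site (d + 1), ∑ b : Fin (d + 1), sgnK Y y₁ z (Sum.inr m) (Sum.inl b) * t b z = -∑ b : Fin (d + 1), Y y₁ z (Sum.inr m) (Sum.inl b) * t b z := by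
    intro z
    rw [← Finset.sum_neg_distrib]
    exact Finset.sum_congr rfl fun b _ => by rw [sgnK_apply, sgnF_inr, sgnF_inl]; ring
  rw [tsum_congr es, tsum_neg, hkill, neg_zero]

/-- [folklore] **THE SWAP WORD `(R_{u′} ∘ Y) ∘ P` SUMMED OVER THE BOND `u′` VANISHES** when `P` (bi-localised at one point) has no ff block, the middle kernel is
`sgnK`-symmetric (`trK Y = sgnK Y` — every dressed step kernel, `LayerCommutatorAntisymm.trK_unitK_coDress`), the right family is antisymmetric under the exchange of its legs
(`trK (R u′) = −R u′`) with no multiplier first legs against `inl α′`, and the multiplier rows of `Y` kill the `ρ₁`-weighted bond-resummed current read at the leg `inl α′`,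
`t′(b,z) = Σ'_{(u′,y)} ρ₁(y)·R_{u′} z y (inl b)(inl α′)`.  ROUTE (24 §3 verbatim): the two-face pair sum of `K` at `(inl α′, inl β′)` is that of `trK K` at `(inl β′, inl α′)`
(`tsum_twoFace_eq_trK`); `trK` reverses the word (`trK_comp`), so it is MINUS the §1 word with `P ↦ trK P`, `Y ↦ sgnK Y`, weights exchanged. -/
theorem tsum_left_right_noFF_swap_word_eq_zero_of_current (hP : BiLoc P p p CP δP) (hδP : 0 < δP)
    (hPff : ∀ (y z : Site (d + 1)) (α' a : Fin (d + 1)), P y z (Sum.inl α') (Sum.inl a) = 0)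
    (hY : Decays Y CY δY) (hδY : 0 < δY) (hYt : trK Y = sgnK Y)
    (hR : ∀ u', BiLoc (R u') ((N : ℤ) • u') ((N : ℤ) • u') CR δR) (hδR : 0 < δR) (hRt : ∀ u', trK (R u') = -R u')
    {α' : Fin (d + 1)} (hRmf : ∀ (u' z w : Site (d + 1)) (m : Fin (d + 1)), R u' z w (Sum.inr m) (Sum.inl α') = 0)
    {ρ₁ ρ₂ : Site (d + 1) → ℝ} (h₁ : ∀ y, |ρ₁ y| ≤ 1) (h₂ : ∀ w, |ρ₂ w| ≤ 1)
    {t' : Fin (d + 1) → Site (d + 1) → ℝ} {M : ℝ}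
    (ht' : ∀ (b : Fin (d + 1)) (z : Site (d + 1)), ∑' uy : Site (d + 1) × Site (d + 1), ρ₁ uy.2 * R uy.1 z uy.2 (Sum.inl b) (Sum.inl α') = t' b z)
    (htb' : ∀ b z, |t' b z| ≤ M) (hkill' : ∀ (y₁ : Site (d + 1)) (m : Fin (d + 1)), ∑' z : Site (d + 1), ∑ b : Fin (d + 1), Y y₁ z (Sum.inr m) (Sum.inl b) * t' b z = 0)
    (β' : Fin (d + 1)) :
    ∑' u' : Site (d + 1), ∑' yw : Site (d + 1) × Site (d + 1), ρ₁ yw.1 * ρ₂ yw.2 * comp (comp (R u') Y) P yw.1 yw.2 (Sum.inl α') (Sum.inl β') = 0 := by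
  classical
  obtain ⟨δ, CA, hδ, hCA, hYd, hRd, hA, hPδ⟩ := exists_common_rate (N := N) hP hδP hY hδY hR hδR
  -- tameness for the re-association
  have hTP : Tame (trK P) := Loc.tame ⟨_, _, _, _, hδ, biLoc_trK hPδ⟩
  have hTY : Tame (sgnK Y) := Spr.tame ⟨_, _, hδ, decays_sgnK hYd⟩
  have hTR : ∀ u' : Site (d + 1), Tame (R u') := fun u' => Loc.tame ⟨_, _, _, _, hδ, hRd u'⟩
  -- per bond: the word is minus the transposed word
  have e : ∀ u' : Site (d + 1), (∑' yw : Site (d + 1) × Site (d + 1), ρ₁ yw.1 * ρ₂ yw.2 * comp (comp (R u') Y) P yw.1 yw.2 (Sum.inl α') (Sum.inl β')) =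
      -∑' wy : Site (d + 1) × Site (d + 1), ρ₂ wy.1 * ρ₁ wy.2 * comp (comp (trK P) (sgnK Y)) (R u') wy.1 wy.2 (Sum.inl β') (Sum.inl α') := by
    intro u'
    refine (tsum_twoFace_eq_trK (comp (comp (R u') Y) P) ρ₁ ρ₂ (Sum.inl α') (Sum.inl β')).trans ?_
    rw [trK_comp, trK_comp, hYt, hRt u', comp_neg_right, comp_neg_right, comp_assoc_tame hTP hTY (hTR u'), ← tsum_neg]
    exact tsum_congr fun wy => by simp only [Pi.neg_apply]; ring
  rw [tsum_congr e, tsum_neg, neg_eq_zero]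
  -- the transposed word: §1 with `P ↦ trK P`, `Y ↦ sgnK Y`, weights exchanged, legs `(β′, α′)`
  exact tsum_noFF_left_right_word_eq_zero_of_current (N := N) (biLoc_trK hP) hδP (trK_noFF hPff) (decays_sgnK hY) hδY hR hδR hRmf h₂ h₁ ht' htb'
    (tsum_sgnK_inr_mul_eq_zero hkill') β'

end Swap

end Summit.QuantumFields.BalabanUV.Beta.GAN24.NoFFWordCurrentKill

end
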